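import Literature.AlgebraicGeometry.HodgeTheory.DworkSexticReflectionQuotient
import Literature.AlgebraicGeometry.Motives.FanoRationallyChainConnected
import HarnessLib

/-!
# Bini–Garbagnati Prop. 3.20 verbatim — the reflection quotient of the Dwork sextic is a smooth FANO fourfold —
# and the route's composite fact from it and Kollár–Miyaoka–Mori

Family `hodge`, layer `Literature/AlgebraicGeometry/HodgeTheory` (namespace `DworkSextic`). ONE named fact
(`BiniGarbagnati2012_reflectionQuotient_isFano`, the verbatim statement of Bini–Garbagnati, *Quotients of the
Dwork pencil*, J. Geom. Phys. 75 (2014), Prop. 3.20: "If `n+1` is even, the quotient `Z := X_λ^{n+1}/⟨τ⟩` is a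
smooth Fano variety", read in the tree's `Motives.IsFano` = smooth projective + ample Cartier divisor `D` with
`[𝒪(D)]·[ω] = 1`, Debarre 2001 §3.2) and ONE REDUCTION: the composite named fact
`DworkSextic.BiniGarbagnati2012_reflectionQuotient_smoothProjective_rcc` of `DworkSexticReflectionQuotient`
(on which crux K1 `ReflectionQuotientDescent` of route `HodgeConjecture/DworkReflectionQuotients`,
stmt-HodgeConjecture-20240, rests: `Theorems/DworkReflectionQuotientsK1OfBiniGarbagnati`) FOLLOWS from the
verbatim Prop. 3.20 and the tree's named fact `Motives.KollarMiyaokaMori1992_fano_rationallyChainConnected`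
(Fano ⟹ rationally chain connected) — `BiniGarbagnati2012_reflectionQuotient_smoothProjective_rcc_of_isFano`.
The split recommended by the K1 repair census (prover seat `hodge-nonav-20241-p1`, g8): the route's residual
print dependence at K1 becomes {B–G 3.20 verbatim, KMM 1992 Thm. 0.1}, two refereed theorems with locators,
instead of one composite. Written by the prover seat `hodge-nonav-20241-p1` (g9).

## References

* [BiniGarbagnati2012] G. Bini, A. Garbagnati, Quotients of the Dwork pencil, J. Geom. Phys. 75 (2014) 173–198
  = arXiv:1207.7175, §3.4 and Prop. 3.20 (p. 17 of the arXiv text).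
* [KollarMiyaokaMori1992] J. Kollár, Y. Miyaoka, S. Mori, Rational connectedness and boundedness of Fano
  manifolds, J. Differential Geom. 36 (1992), Thm. 0.1 / Thm. 3.3.
* [Debarre2001] O. Debarre, Higher-Dimensional Algebraic Geometry (2001), §3.2, Prop. 5.16.
-/

noncomputable section

namespace Literature.AlgebraicGeometry.HodgeTheory.DworkSextic

open Literature.AlgebraicGeometry.Motives

/-- **Bini–Garbagnati 2012, Prop. 3.20, verbatim: for `ψ⁶ ≠ 1` the quotient `X_ψ/⟨s_(i,j,ζ)⟩` of the Dwork
sextic fourfold by a coordinate reflection is a smooth FANO fourfold.** (arXiv:1207.7175 p. 17, for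
`X_λ^{n+1} : Σ x_l^{n+1} − (n+1)λ ∏ x_l = 0 ⊂ ℙⁿ` and `τ = (12)`: "If `n+1` is even, the fixed locus of `τ` is
the divisor `X_λ^{n+1} ∩ {x_1 = x_2}` …; the quotient `X_λ^{n+1}/⟨τ⟩` is a smooth variety. … **Proposition
3.20.** If `n+1` is even, the quotient `Z := X_λ^{n+1}/⟨τ⟩` is a smooth Fano variety. Moreover, it is a degree
`(n+1)/2` covering of `ℙ^{n−1}`, where the ramification divisor `R` is linearly equivalent to `(1−n)K_Z`";
`p^*(−K_Z) = h` by Riemann–Hurwitz.) Here `n + 1 = 6`, `λ = ψ`, `ψ⁶ ≠ 1` (smooth members, Katz Lemma 2.1);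
every `s_(i,j,ζ)` is conjugate to `(12)` in `Aut(X_ψ)` (§3.4, "We may assume that `τ` is the transposition
`(12)`"), so the fact is stated for all `(i, j, ζ)`; "smooth Fano variety" is the tree's `Motives.IsFano 4`
(Debarre §3.2: smooth projective with ample anticanonical class, `[𝒪(D)]·[ω_Z] = 1` in `CechPic`) of the
constructed quotient `DworkSextic.reflQuotient`. [cite: BiniGarbagnati2012, Prop. 3.20 (arXiv p. 17) and §3.4]
[cite: Debarre2001, §3.2] -/
def BiniGarbagnati2012_reflectionQuotient_isFano : Prop :=
  ∀ (ψ : ℂ), ψ ^ 6 ≠ 1 → ∀ (i j : Fin 6) (hij : i ≠ j) (ζ : ℂ) (hζ : ζ ^ 6 = 1),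
    IsFano 4 (reflQuotient ψ hij hζ)

/-- **The route's composite fact follows from Prop. 3.20 verbatim and Kollár–Miyaoka–Mori**: a smooth Fano
variety over `ℂ` is smooth projective (`IsFano.isSmoothProjective`) and rationally chain connected
(`KollarMiyaokaMori1992_fano_rationallyChainConnected`, Thm. 0.1 / 3.3), which is
`BiniGarbagnati2012_reflectionQuotient_smoothProjective_rcc` for every reflection quotient of every smooth
member. [cite: BiniGarbagnati2012, Prop. 3.20] [cite: KollarMiyaokaMori1992, Thm. 0.1] -/
theorem BiniGarbagnati2012_reflectionQuotient_smoothProjective_rcc_of_isFano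
    (hF : BiniGarbagnati2012_reflectionQuotient_isFano)
    (hK : KollarMiyaokaMori1992_fano_rationallyChainConnected) :
    BiniGarbagnati2012_reflectionQuotient_smoothProjective_rcc :=
  fun ψ hψ i j hij ζ hζ =>
    ⟨(hF ψ hψ i j hij ζ hζ).isSmoothProjective, hK (hF ψ hψ i j hij ζ hζ)⟩

end Literature.AlgebraicGeometry.HodgeTheory.DworkSextic

end
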